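import Literature.NumberTheory.Automorphic.GKCohomology
import Literature.NumberTheory.Automorphic.GKModulesOneParameter
import HarnessLib

/-!
# Contragredient `(𝔤, K)`-module data and `H^q(𝔤, K; V^*)`

Topic `NumberTheory/Automorphic`; namespace `Literature.NumberTheory.Automorphic.GKDual`.
Definitions with bodies and theorems only (no named fact, no `sorry`).

For `(𝔤, K)`-module data `(ρK, ρ𝔤)` on `V` over the tree's `G : RealMatrixGroup A N`, the dual
`V^* = Module.Dual ℂ V` carries the contragredient actions [cite: BorelWallach2000, 0 §2.5]:

* the `K`-action is Mathlib's `ρK.dual : Representation ℂ K V^*` (`k • ℓ = ℓ ∘ ρK k⁻¹`,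
  `dual_apply_apply`); `GKDual.lie G ρ𝔤 : 𝔤 →ₗ⁅ℝ⁆ End V^*` — `X • ℓ = -ℓ ∘ ρ𝔤 X` (a morphism of
  real Lie algebras; `lie_apply`);
* `GKDual.ad_compat` — the compatibility axiom `ρK k ∘ ρ𝔤 X ∘ ρK k⁻¹ = ρ𝔤 (Ad k X)` passes to the
  dual; hence `GKDual.cohomology … q` — **`H^q(𝔤, K; V^*)`** (a complex vector space, via
  `GKCohomology`);
* `GKDual.kFiniteVectors σ` — the `K`-finite vectors of a `K`-representation (a `ℂ`-submodule),
  `kFiniteVectors_stable` (`K`-stable) and `lie_mem_kFiniteVectors` — for finite-dimensional `𝔤`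
  the `K`-finite dual vectors are `𝔤`-stable, so that they form the **contragredient
  `(𝔤, K)`-module** `Ṽ` of [cite: BorelWallach2000, 0 §2.5] (the `χ_Ṽ` of Wigner's lemma
  [cite: BorelWallach2000, I Thm. 5.3]);
* `GKDual.carrier`, `GKDual.Kfin`, `GKDual.lieFin` — the restricted actions on the `K`-finite dual
  `Ṽ`, and **`GKDual.isGKModule`: the contragredient of a `(𝔤, K)`-module is a `(𝔤, K)`-module**
  (`IsGKModule G (Kfin G ρK) (lieFin G ρK ρ𝔤 _)`, for finite-dimensional `𝔤`) — weak continuity and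
  the weak derivative along `𝔨` are reduced to those of `V` by `GKDual.exists_eval_eq` (a functional
  on a finite-dimensional space of functionals is evaluation at a vector)
  [cite: BorelWallach2000, 0 §2.5].

Not here: admissibility and `Ṽ̃ = V`, Poincaré duality.

## Mathlib / Literature search

`Representation.dual` (Mathlib) is the contragredient `K`-action and is reused; Mathlib has no
`(𝔤, K)`-modules (`IsGKModule` is the tree's, `GKModules`), no infinitesimal contragredient and no
`K`-finite vectors of an abstract representation (`GKModules.kFiniteVectors` is for continuous
Hilbert representations of `G`); `LinearMap.flip_surjective_iff₁` supplies `exists_eval_eq`.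

## References

* A. Borel, N. Wallach (2000), 0 §2.5; I Thm. 5.3 (held) [BorelWallach2000].
-/

noncomputable section

namespace Literature.NumberTheory.Automorphic

open Module

-- Mathlib idiom (as in `GKModules`): commutator bracket on `Module.End`
attribute [local instance 100] LieRing.ofAssociativeRing

variable {A : Type*} [NormedCommRing A] [NormedAlgebra ℝ A] [NormedAlgebra ℚ A] [CompleteSpace A]
  [StarRing A] {N : Type*} [Fintype N] [DecidableEq N] (G : RealMatrixGroup A N)
  {V : Type*} [AddCommGroup V] [Module ℂ V]
  (ρK : Representation ℂ G.maximalCompact V) (ρ𝔤 : G.lie →ₗ⁅ℝ⁆ Module.End ℂ V)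

namespace GKDual

/-- The contragredient `K`-action on the dual is Mathlib's `Representation.dual`:
`ρK.dual k ℓ = ℓ ∘ ρK k⁻¹` [cite: BorelWallach2000, 0 §2.5]; this is its pointwise unfolding
(Mathlib's `Representation.dual_apply` is phrased with `Module.Dual.transpose`). [folklore] -/
theorem dual_apply_apply (k : G.maximalCompact) (ℓ : Dual ℂ V) (v : V) :
    ρK.dual k ℓ v = ℓ (ρK k⁻¹ v) := rfl

/-- The contragredient infinitesimal action on the dual: `X • ℓ = -ℓ ∘ ρ𝔤 X`.
[cite: BorelWallach2000, 0 §2.5] -/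
def lie : G.lie →ₗ⁅ℝ⁆ Module.End ℂ (Dual ℂ V) where
  toFun X := -(ρ𝔤 X).dualMap
  map_add' X Y := by
    ext ℓ v
    simp only [map_add, LinearMap.neg_apply, LinearMap.add_apply, LinearMap.dualMap_apply, neg_add]
  map_smul' t X := by
    ext ℓ v
    change -(ℓ (ρ𝔤 (t • X) v)) = t • (-(ℓ (ρ𝔤 X v)))
    rw [map_smul, LinearMap.smul_apply, LinearMap.map_smul_of_tower, smul_neg]
  map_lie' {X Y} := by
    ext ℓ v
    simp only [LieHom.map_lie, Ring.lie_def, LinearMap.neg_apply, LinearMap.sub_apply,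
      LinearMap.dualMap_apply, Module.End.mul_apply, map_sub, LinearMap.neg_apply, neg_sub]
    abel

/-- Unfolding. [folklore] -/
@[simp] theorem lie_apply (X : G.lie) (ℓ : Dual ℂ V) (v : V) :
    lie G ρ𝔤 X ℓ v = -ℓ (ρ𝔤 X v) := rfl

/-- **The contragredient data satisfy the `(𝔤, K)`-compatibility axiom.**
[cite: BorelWallach2000, 0 §2.5] -/
theorem ad_compat
    (had : ∀ (k : G.maximalCompact) (X : G.lie),
      ρK k ∘ₗ ρ𝔤 X ∘ₗ ρK k⁻¹ = ρ𝔤 (G.Ad (Subgroup.inclusion G.maximalCompact_le_carrier k) X))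
    (k : G.maximalCompact) (X : G.lie) :
    ρK.dual k ∘ₗ lie G ρ𝔤 X ∘ₗ ρK.dual k⁻¹ =
      lie G ρ𝔤 (G.Ad (Subgroup.inclusion G.maximalCompact_le_carrier k) X) := by
  ext ℓ v
  simp only [LinearMap.coe_comp, Function.comp_apply, dual_apply_apply, lie_apply, inv_inv]
  rw [← had k X]
  rfl

variable [StarModule ℝ A]

/-- **`H^q(𝔤, K; V^*)`** — the `(𝔤, K)`-cohomology with coefficients in the (algebraic) dual with
the contragredient actions. [cite: BorelWallach2000, I §5.1 (4)] -/
abbrev cohomology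
    (had : ∀ (k : G.maximalCompact) (X : G.lie),
      ρK k ∘ₗ ρ𝔤 X ∘ₗ ρK k⁻¹ = ρ𝔤 (G.Ad (Subgroup.inclusion G.maximalCompact_le_carrier k) X))
    (q : ℕ) : Type _ :=
  gkCohomology G ρK.dual (lie G ρ𝔤) (ad_compat G ρK ρ𝔤 had) q

example
    (had : ∀ (k : G.maximalCompact) (X : G.lie),
      ρK k ∘ₗ ρ𝔤 X ∘ₗ ρK k⁻¹ = ρ𝔤 (G.Ad (Subgroup.inclusion G.maximalCompact_le_carrier k) X))
    (q : ℕ) : Module ℂ (cohomology G ρK ρ𝔤 had q) := inferInstance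

/-! #### The `K`-finite part (the contragredient `(𝔤, K)`-module proper) -/

/-- The `K`-finite vectors of a `K`-representation: those whose orbit spans a finite-dimensional
subspace. [cite: BorelWallach2000, 0 §2.5] -/
def kFiniteVectors {W : Type*} [AddCommGroup W] [Module ℂ W]
    (σ : Representation ℂ G.maximalCompact W) : Submodule ℂ W where
  carrier :=
    {w | FiniteDimensional ℂ (Submodule.span ℂ (Set.range fun k : G.maximalCompact ↦ σ k w))}
  add_mem' {a b} ha hb := by
    change FiniteDimensional ℂ _ at ha hb ⊢
    have hle : Submodule.span ℂ (Set.range fun k : G.maximalCompact ↦ σ k (a + b)) ≤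
        Submodule.span ℂ (Set.range fun k : G.maximalCompact ↦ σ k a) ⊔
          Submodule.span ℂ (Set.range fun k : G.maximalCompact ↦ σ k b) := by
      rw [Submodule.span_le]
      rintro _ ⟨k, rfl⟩
      dsimp only
      rw [map_add]
      exact Submodule.add_mem_sup (Submodule.subset_span ⟨k, rfl⟩) (Submodule.subset_span ⟨k, rfl⟩)
    exact Submodule.finiteDimensional_of_le hle
  zero_mem' := by
    change FiniteDimensional ℂ _
    have hle : Submodule.span ℂ (Set.range fun k : G.maximalCompact ↦ σ k (0 : W)) ≤ ⊥ := by
      rw [Submodule.span_le]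
      rintro _ ⟨k, rfl⟩
      simp
    exact Submodule.finiteDimensional_of_le hle
  smul_mem' c w hw := by
    change FiniteDimensional ℂ _ at hw ⊢
    have hle : Submodule.span ℂ (Set.range fun k : G.maximalCompact ↦ σ k (c • w)) ≤
        Submodule.span ℂ (Set.range fun k : G.maximalCompact ↦ σ k w) := by
      rw [Submodule.span_le]
      rintro _ ⟨k, rfl⟩
      dsimp only
      rw [map_smul]
      exact Submodule.smul_mem _ c (Submodule.subset_span ⟨k, rfl⟩)
    exact Submodule.finiteDimensional_of_le hle

omit [StarModule ℝ A] in
/-- Membership in the `K`-finite vectors. [folklore] -/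
theorem mem_kFiniteVectors_iff {W : Type*} [AddCommGroup W] [Module ℂ W]
    (σ : Representation ℂ G.maximalCompact W) (w : W) :
    w ∈ kFiniteVectors G σ ↔
      FiniteDimensional ℂ (Submodule.span ℂ (Set.range fun k : G.maximalCompact ↦ σ k w)) :=
  Iff.rfl

omit [StarModule ℝ A] in
/-- The `K`-finite vectors are `K`-stable. [folklore] -/
theorem kFiniteVectors_stable {W : Type*} [AddCommGroup W] [Module ℂ W]
    (σ : Representation ℂ G.maximalCompact W) (k : G.maximalCompact) {w : W}
    (hw : w ∈ kFiniteVectors G σ) : σ k w ∈ kFiniteVectors G σ := by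
  rw [mem_kFiniteVectors_iff] at hw ⊢
  have hle : Submodule.span ℂ (Set.range fun h : G.maximalCompact ↦ σ h (σ k w)) ≤
      Submodule.span ℂ (Set.range fun h : G.maximalCompact ↦ σ h w) := by
    rw [Submodule.span_le]
    rintro _ ⟨h, rfl⟩
    refine Submodule.subset_span ⟨h * k, ?_⟩
    simp only [map_mul, Module.End.mul_apply]
  exact Submodule.finiteDimensional_of_le hle

omit [StarModule ℝ A] in
/-- **The `K`-finite dual vectors are `𝔤`-stable** when `𝔤` is finite-dimensional: for `ℓ`
`K`-finite, the `K`-orbit of `X • ℓ` is `k ↦ (Ad k X) • (k • ℓ)` (compatibility axiom), which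
lies in `Σⱼ (X ↦ Yⱼ • ·)(span K ℓ)` for a basis `(Yⱼ)` of `𝔤`. [cite: BorelWallach2000, 0 §2.5] -/
theorem lie_mem_kFiniteVectors [Module.Finite ℝ G.lie]
    (had : ∀ (k : G.maximalCompact) (X : G.lie),
      ρK k ∘ₗ ρ𝔤 X ∘ₗ ρK k⁻¹ = ρ𝔤 (G.Ad (Subgroup.inclusion G.maximalCompact_le_carrier k) X))
    (X : G.lie) {ℓ : Dual ℂ V} (hℓ : ℓ ∈ kFiniteVectors G ρK.dual) :
    lie G ρ𝔤 X ℓ ∈ kFiniteVectors G ρK.dual := by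
  rw [mem_kFiniteVectors_iff] at hℓ ⊢
  set P := Submodule.span ℂ (Set.range fun k : G.maximalCompact ↦ ρK.dual k ℓ)
  let b := Module.finBasis ℝ G.lie
  -- the finite-dimensional target `Σⱼ (lie Yⱼ)(P)`
  let Q : Submodule ℂ (Dual ℂ V) := ⨆ j, P.map (lie G ρ𝔤 (b j))
  haveI : ∀ j, FiniteDimensional ℂ (P.map (lie G ρ𝔤 (b j))) := fun j => inferInstance
  haveI : FiniteDimensional ℂ Q := Submodule.finiteDimensional_iSup _
  refine Submodule.finiteDimensional_of_le (S₂ := Q) ?_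
  rw [Submodule.span_le]
  rintro _ ⟨k, rfl⟩
  -- `k • (X • ℓ) = (Ad k X) • (k • ℓ)`
  have hcomm : ρK.dual k (lie G ρ𝔤 X ℓ) =
      lie G ρ𝔤 (G.Ad (Subgroup.inclusion G.maximalCompact_le_carrier k) X) (ρK.dual k ℓ) := by
    have e := LinearMap.congr_fun (ad_compat G ρK ρ𝔤 had k X) (ρK.dual k ℓ)
    simp only [LinearMap.coe_comp, Function.comp_apply] at e
    rw [← e, ← Module.End.mul_apply (f := ρK.dual k⁻¹), ← map_mul, inv_mul_cancel, map_one,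
      Module.End.one_apply]
  change ρK.dual k (lie G ρ𝔤 X ℓ) ∈ Q
  rw [hcomm, ← b.sum_repr (G.Ad (Subgroup.inclusion G.maximalCompact_le_carrier k) X), map_sum,
    LinearMap.sum_apply]
  refine Submodule.sum_mem _ fun j _ => ?_
  rw [map_smul, LinearMap.smul_apply]
  change ((b.repr _ j : ℝ) : ℂ) • lie G ρ𝔤 (b j) (ρK.dual k ℓ) ∈ Q
  refine Submodule.smul_mem _ _ (Submodule.mem_iSup_of_mem j ?_)
  exact Submodule.mem_map_of_mem (Submodule.subset_span ⟨k, rfl⟩)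


section Contragredient

/-! ### The contragredient `(𝔤, K)`-module `Ṽ` is a `(𝔤, K)`-module -/

omit [NormedAlgebra ℚ A] [CompleteSpace A] [StarRing A] [Fintype N] [DecidableEq N] in
/-- **A functional on a finite-dimensional space of functionals is evaluation at a vector.** For a
finite-dimensional subspace `P` of a subspace `W ⊆ V^*` and `L ∈ W^*` there is `v ∈ V` with
`L p = p v` for all `p ∈ P` (the evaluation pairing `P × V → ℂ` is injective on `P`, hence — `P`
being finite-dimensional — surjective onto `P^*`; Mathlib's `LinearMap.flip_surjective_iff₁`).
[folklore] -/
theorem exists_eval_eq {W : Submodule ℂ (Dual ℂ V)} (P : Submodule ℂ W) [FiniteDimensional ℂ P]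
    (L : Dual ℂ W) : ∃ v : V, ∀ p ∈ P, L p = (p : Dual ℂ V) v := by
  let B : P →ₗ[ℂ] V →ₗ[ℂ] ℂ := W.subtype ∘ₗ P.subtype
  have hB : Function.Injective B := W.injective_subtype.comp P.injective_subtype
  have hsurj : Function.Surjective B.flip :=
    (LinearMap.flip_surjective_iff₁ (K := ℂ) (V₁ := P) (V₂ := V) (B := B)).mpr hB
  obtain ⟨v, hv⟩ := hsurj (L.domRestrict P)
  refine ⟨v, fun p hp => ?_⟩
  have e := LinearMap.congr_fun hv ⟨p, hp⟩
  rw [LinearMap.flip_apply, LinearMap.domRestrict_apply] at e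
  exact e.symm

/-- The `K`-finite dual `Ṽ ⊆ V^*` (the carrier of the contragredient `(𝔤, K)`-module).
[cite: BorelWallach2000, 0 §2.5] -/
abbrev carrier : Submodule ℂ (Dual ℂ V) := kFiniteVectors G ρK.dual

/-- The contragredient `K`-action on the `K`-finite dual `Ṽ`. [cite: BorelWallach2000, 0 §2.5] -/
def Kfin : Representation ℂ G.maximalCompact (carrier G ρK) where
  toFun k := (ρK.dual k).restrict fun _ hℓ => kFiniteVectors_stable G ρK.dual k hℓ
  map_one' := by
    refine LinearMap.ext fun ℓ => Subtype.ext ?_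
    rw [LinearMap.coe_restrict_apply, map_one]
    rfl
  map_mul' g h := by
    refine LinearMap.ext fun ℓ => Subtype.ext ?_
    rw [LinearMap.coe_restrict_apply, map_mul]
    rfl

omit [StarModule ℝ A] in
/-- Unfolding. [folklore] -/
@[simp] theorem coe_Kfin_apply (k : G.maximalCompact) (ℓ : carrier G ρK) :
    (Kfin G ρK k ℓ : Dual ℂ V) = ρK.dual k ℓ := rfl

omit [StarModule ℝ A] in
/-- The orbit spans in `Ṽ` are finite-dimensional (they map isomorphically onto the orbit spans in
`V^*`). [folklore] -/
theorem Kfin_kFinite (ℓ : carrier G ρK) :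
    FiniteDimensional ℂ
      (Submodule.span ℂ (Set.range fun k : G.maximalCompact ↦ Kfin G ρK k ℓ)) := by
  have hℓ := (mem_kFiniteVectors_iff G ρK.dual (ℓ : Dual ℂ V)).mp ℓ.2
  have hmap : (Submodule.span ℂ (Set.range fun k : G.maximalCompact ↦ Kfin G ρK k ℓ)).map
      (carrier G ρK).subtype =
      Submodule.span ℂ (Set.range fun k : G.maximalCompact ↦ ρK.dual k ℓ) := by
    rw [Submodule.map_span, ← Set.range_comp]
    rfl
  have e := Submodule.equivMapOfInjective _ (carrier G ρK).injective_subtype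
    (Submodule.span ℂ (Set.range fun k : G.maximalCompact ↦ Kfin G ρK k ℓ))
  rw [hmap] at e
  exact LinearEquiv.finiteDimensional e.symm

/-- The contragredient infinitesimal action on the `K`-finite dual `Ṽ` (for finite-dimensional
`𝔤`, using the compatibility axiom of `V`). [cite: BorelWallach2000, 0 §2.5] -/
def lieFin [Module.Finite ℝ G.lie]
    (had : ∀ (k : G.maximalCompact) (X : G.lie),
      ρK k ∘ₗ ρ𝔤 X ∘ₗ ρK k⁻¹ = ρ𝔤 (G.Ad (Subgroup.inclusion G.maximalCompact_le_carrier k) X)) :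
    G.lie →ₗ⁅ℝ⁆ Module.End ℂ (carrier G ρK) where
  toFun X := (lie G ρ𝔤 X).restrict fun _ hℓ => lie_mem_kFiniteVectors G ρK ρ𝔤 had X hℓ
  map_add' X Y := by
    refine LinearMap.ext fun ℓ => Subtype.ext ?_
    change lie G ρ𝔤 (X + Y) (ℓ : Dual ℂ V) = lie G ρ𝔤 X (ℓ : Dual ℂ V) + lie G ρ𝔤 Y (ℓ : Dual ℂ V)
    rw [map_add, LinearMap.add_apply]
  map_smul' t X := by
    refine LinearMap.ext fun ℓ => Subtype.ext ?_
    change lie G ρ𝔤 (t • X) (ℓ : Dual ℂ V) = (t : ℂ) • lie G ρ𝔤 X (ℓ : Dual ℂ V)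
    rw [map_smul]
    rfl
  map_lie' {X Y} := by
    refine LinearMap.ext fun ℓ => Subtype.ext ?_
    change lie G ρ𝔤 ⁅X, Y⁆ (ℓ : Dual ℂ V) = _
    rw [LieHom.map_lie]
    rfl

omit [StarModule ℝ A] in
/-- Unfolding. [folklore] -/
@[simp] theorem coe_lieFin_apply [Module.Finite ℝ G.lie]
    (had : ∀ (k : G.maximalCompact) (X : G.lie),
      ρK k ∘ₗ ρ𝔤 X ∘ₗ ρK k⁻¹ = ρ𝔤 (G.Ad (Subgroup.inclusion G.maximalCompact_le_carrier k) X))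
    (X : G.lie) (ℓ : carrier G ρK) :
    (lieFin G ρK ρ𝔤 had X ℓ : Dual ℂ V) = lie G ρ𝔤 X ℓ := rfl

variable [ContinuousStar A]

/-- `(exp tX)⁻¹ = exp (-t X)` in `K`. [folklore] -/
theorem expK_smul_inv (t : ℝ) (X : G.compactLie) : (G.expK (t • X))⁻¹ = G.expK ((-t) • X) := by
  refine inv_eq_of_mul_eq_one_right ?_
  rw [← RealMatrixGroup.expK_add_smul, add_neg_cancel, RealMatrixGroup.expK_zero_smul]

/-- **The contragredient of a `(𝔤, K)`-module is a `(𝔤, K)`-module** (for finite-dimensional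
`𝔤`): the `K`-finite dual `Ṽ` with `k • ℓ = ℓ ∘ ρK k⁻¹`, `X • ℓ = -ℓ ∘ ρ𝔤 X` satisfies the
axioms `IsGKModule` — `K`-finiteness by construction, the compatibility axiom from that of `V`,
and weak continuity / the weak derivative along `𝔨` because every functional on a
finite-dimensional space of functionals is evaluation at a vector of `V` (`exists_eval_eq`), which
reduces them to the axioms of `V` at `k⁻¹`, `exp (-tX)`. [cite: BorelWallach2000, 0 §2.5] -/
theorem isGKModule [Module.Finite ℝ G.lie] (hV : IsGKModule G ρK ρ𝔤) :
    IsGKModule G (Kfin G ρK) (lieFin G ρK ρ𝔤 hV.ad_compat) where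
  kFinite := Kfin_kFinite G ρK
  weaklyContinuous ℓ L := by
    haveI := Kfin_kFinite G ρK ℓ
    obtain ⟨v, hv⟩ := exists_eval_eq
      (Submodule.span ℂ (Set.range fun k : G.maximalCompact ↦ Kfin G ρK k ℓ)) L
    have key : (fun k : G.maximalCompact ↦ L (Kfin G ρK k ℓ)) =
        fun k ↦ (ℓ : Dual ℂ V) (ρK k⁻¹ v) := by
      funext k
      rw [hv _ (Submodule.subset_span ⟨k, rfl⟩)]
      rfl
    rw [key]
    exact (hV.weaklyContinuous v ℓ).comp continuous_inv
  ad_compat k X := by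
    refine LinearMap.ext fun ℓ => Subtype.ext ?_
    exact LinearMap.congr_fun (ad_compat G ρK ρ𝔤 hV.ad_compat k X) (ℓ : Dual ℂ V)
  hasWeakDeriv X ℓ L := by
    set X' : G.lie := LieSubalgebra.inclusion G.compactLie_le_lie X
    set P : Submodule ℂ (carrier G ρK) :=
      Submodule.span ℂ (Set.range fun k : G.maximalCompact ↦ Kfin G ρK k ℓ) ⊔
        (ℂ ∙ lieFin G ρK ρ𝔤 hV.ad_compat X' ℓ)
    haveI := Kfin_kFinite G ρK ℓ
    haveI : FiniteDimensional ℂ P := Submodule.finiteDimensional_sup _ _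
    obtain ⟨v, hv⟩ := exists_eval_eq P L
    have key : (fun t : ℝ ↦ L (Kfin G ρK (G.expK (t • X)) ℓ)) =
        fun t ↦ (ℓ : Dual ℂ V) (ρK (G.expK ((-t) • X)) v) := by
      funext t
      rw [hv _ (Submodule.mem_sup_left (Submodule.subset_span ⟨G.expK (t • X), rfl⟩)),
        ← expK_smul_inv]
      rfl
    have key₂ : L (lieFin G ρK ρ𝔤 hV.ad_compat X' ℓ) = -((ℓ : Dual ℂ V) (ρ𝔤 X' v)) := by
      rw [hv _ (Submodule.mem_sup_right (Submodule.mem_span_singleton_self _))]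
      rfl
    rw [key, key₂]
    have h0 : HasDerivAt (fun t : ℝ ↦ (ℓ : Dual ℂ V) (ρK (G.expK (t • X)) v))
        ((ℓ : Dual ℂ V) (ρ𝔤 X' v)) (-0 : ℝ) := by
      rw [neg_zero]
      exact hV.hasWeakDeriv X v ℓ
    have h1 := h0.scomp (0 : ℝ) (hasDerivAt_neg (0 : ℝ))
    rw [neg_one_smul] at h1
    exact h1

end Contragredient

end GKDual

end Literature.NumberTheory.Automorphic
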